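import Mathlib
import Summits.Ventures.PercRepro2.ThreeTermPinnedCube
import Summits.Ventures.PercRepro2.ThreeTermConeAll
import Summits.Ventures.PercRepro2.TypedRulesSt

/-!
# Three-terminal parts, V b: a concrete core's partition table, evaluated in the kernel
(blind cell PercRepro2, night-3 g30, 2026-08-29; `proofs/NIGHT3-CERT.md` §39.6)

THE CORE `HOB`: the five marks `l = 0` (`a₁`), `h = 1` (`a₂`), `o = 2`, `b = 3`, `a₃ = 4` with the two typed
edges `h–o` (edge `0`) and `h–b` (edge `1`), both of type `1`, and the terminal triple `(l, o, b)` — the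
smallest core of g28's K₅ census with negative symmetric coefficients (`k = 000110000` on the triple
`023`: `C_{⊥·01·02} = −8`, `C_{01·01·02} = −6`, `C_{01·02·02} = −6`, `C_{01·02·12} = −4`, `C_{01·02·⊤} = −4`).
The instance carries the three-terminal STAR at the new vertex `u = 5` (edges `2, 3, 4` to `l, o, b`), so
the part graph (`partEnds`) is the core plus the three virtual edges `{l,o}`, `{l,b}`, `{o,b}`.

* the states `st` of the part graph's configurations are the computable `stC` (Mathlib's decidable
  `Reachable`), tabled on the `32` configurations (`stTab`, one kernel `decide`);
* the per-copy pinned table `partTable5` is, by `typedCount3_eq_sum_setOn`, a sum over the typed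
  assignments of `K₃ = KB ∘ st` at the pinned configurations; transported to `Fin 32` and the state
  table it is the integer `entryZ`, and **`entryZ_eq`** evaluates all `125` entries by one kernel
  `decide` — **`partTable5_eq`**: the table IS `tbl5` (two codes off the kernel: g27's tristate3.c and
  a literal Python twin of these definitions agree entry by entry);
* **`inCone_HOB`**: the five-world cubic of `tbl5` lies in the Harris cone — the certificate of
  certlp.py (ten monomials and the five generators `μ_i · H12` with multipliers `8, 6, 6, 4, 4`: the
  cross-pair deficits paid by `d ≥ ab`, the shape of §37.5);
* **`typedCount_nonneg_HOB`**: row 2′TRI on the core plus the star at `u` for EVERY type map on the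
  star (`64` patterns) — the chain `typedCount_part_nonneg_of_inCone5'` end to end on one core.

Own work; standard axioms (the table by `decide +kernel`).
-/

namespace Summit.Ventures.PercRepro2

open TypedStar Part ThreeTerm CovForm CovForm.OneTyped CovForm.TypedRed

namespace InstHOB

/-! ## The instance -/

/-- The star instance: `l = 0, h = 1, o = 2, b = 3, a₃ = 4, u = 5`; edges `0 : h–o`, `1 : h–b`,
`2 : u–l`, `3 : u–o`, `4 : u–b`. -/
def ends : Fin 5 → Sym2 (Fin 6) := ![s(1, 2), s(1, 3), s(5, 0), s(5, 2), s(5, 3)]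

/-- The star's edges. -/
def S : Finset (Fin 5) := {2, 3, 4}

/-- The core's typed edges. -/
def F : Finset (Fin 5) := {0, 1}

/-- The pinning (irrelevant: every edge is typed). -/
def z₀ : Config (Fin 5) := fun _ => false

/-- The type map of record: type `1` on the core's edges (the star's types are free, see the end). -/
def τ₀ : Fin 5 → ℕ := fun _ => 1

/-- The part graph: the core plus the virtual edges `{l,o}`, `{l,b}`, `{o,b}` (`u` isolated). -/
def pg : Fin 5 → Sym2 (Fin 6) := ![s(1, 2), s(1, 3), s(0, 2), s(0, 3), s(2, 3)]

/-- `partEnds` of the instance is the part graph. -/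
lemma partEnds_eq : partEnds ends (↑S) 2 3 4 0 2 3 = pg := by
  funext e
  fin_cases e <;> rfl

/-- The star is a part: `S` is exactly the set of edges touching `u`. -/
lemma hS : ∀ e, e ∈ S ↔ e ∈ touches ends {5} := by
  intro e
  fin_cases e <;> simp [S, touches, ends]

/-! ## The states of the part graph, tabled -/

/-- The computable state of a configuration of the part graph (Mathlib's decidable `Reachable`):
`(h ↔ l, l ↔ o, h ↔ o, l ↔ b, h ↔ b, l ↔ a₃, h ↔ a₃)`. -/
def stC (ω : Config (Fin 5)) : St :=
  (decide (Conn pg ω 1 0), decide (Conn pg ω 0 2), decide (Conn pg ω 1 2), decide (Conn pg ω 0 3),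
    decide (Conn pg ω 1 3), decide (Conn pg ω 0 4), decide (Conn pg ω 1 4))

/-- The cell's state is the computable state. -/
lemma st_eq_stC (ω : Config (Fin 5)) : st pg 2 0 1 4 3 ω = stC ω := by
  unfold st stC
  refine Prod.ext ?_ (Prod.ext ?_ (Prod.ext ?_ (Prod.ext ?_ (Prod.ext ?_ (Prod.ext ?_ ?_))))) <;>
    exact decide_eq_decide.mpr Iff.rfl

/-- The configuration with bits `n`. -/
def cfgOf (n : Fin 32) : Config (Fin 5) := fun e => n.val.testBit e.val

/-- The bits of a configuration. -/
def enc (ω : Config (Fin 5)) : Fin 32 := Fin.ofNat 32 (∑ e : Fin 5, (ω e).toNat * 2 ^ (e : ℕ))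

/-- Configurations are bit vectors. -/
def cfgEquiv : Config (Fin 5) ≃ Fin 32 where
  toFun := enc
  invFun := cfgOf
  left_inv := by decide
  right_inv := by decide

/-- The `32` states, tabled. -/
def stTab : Fin 32 → St :=
  ![(false, false, false, false, false, false, false),
   (false, false, true, false, false, false, false),
   (false, false, false, false, true, false, false),
   (false, false, true, false, true, false, false),
   (false, true, false, false, false, false, false),
   (true, true, true, false, false, false, false),
   (false, true, false, false, true, false, false),
   (true, true, true, true, true, false, false),
   (false, false, false, true, false, false, false),
   (false, false, true, true, false, false, false),
   (true, false, false, true, true, false, false),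
   (true, true, true, true, true, false, false),
   (false, true, false, true, false, false, false),
   (true, true, true, true, true, false, false),
   (true, true, true, true, true, false, false),
   (true, true, true, true, true, false, false),
   (false, false, false, false, false, false, false),
   (false, false, true, false, true, false, false),
   (false, false, true, false, true, false, false),
   (false, false, true, false, true, false, false),
   (false, true, false, true, false, false, false),
   (true, true, true, true, true, false, false),
   (true, true, true, true, true, false, false),
   (true, true, true, true, true, false, false),
   (false, true, false, true, false, false, false),
   (true, true, true, true, true, false, false),
   (true, true, true, true, true, false, false),
   (true, true, true, true, true, false, false),
   (false, true, false, true, false, false, false),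
   (true, true, true, true, true, false, false),
   (true, true, true, true, true, false, false),
   (true, true, true, true, true, false, false)]

set_option maxRecDepth 100000 in
/-- The table is the state function (one kernel `decide`: `224` connection decisions). -/
lemma stC_cfgOf : ∀ n : Fin 32, stC (cfgOf n) = stTab n := by decide +kernel

/-- The pin of pattern `p` on the star's edges. -/
def pin (p : Fin 5) : Config (Fin 5) := setOn S (cfg 2 3 4 (rep5 p)) z₀

/-- The bits of the configuration `cfgOf i` on the core's edges with the pin `p` on the star's. -/
def mix (i : Fin 32) (p : Fin 5) : Fin 32 :=
  ⟨i.val % 4 + 4 * (rep5 p).val, by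
    have h1 := Nat.mod_lt i.val (show 0 < 4 by norm_num)
    have h2 := (rep5 p).isLt
    omega⟩

/-- The pinned configuration is a bit vector. -/
lemma setOn_cfgOf : ∀ (i : Fin 32) (p : Fin 5), setOn F (cfgOf i) (pin p) = cfgOf (mix i p) := by
  decide

/-! ## The table -/

/-- The typed-assignment condition on three bit vectors. -/
abbrev cond (t : Fin 32 × Fin 32 × Fin 32) : Prop :=
  (SuppOn F (cfgOf t.1) ∧ SuppOn F (cfgOf t.2.1) ∧ SuppOn F (cfgOf t.2.2)) ∧
    ∀ e ∈ F, openCount (cfgOf t.1) (cfgOf t.2.1) (cfgOf t.2.2) e = τ₀ e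

/-- The nine typed assignments of the two core edges (edge `0` in one copy, edge `1` in one copy). -/
def T9 : Finset (Fin 32 × Fin 32 × Fin 32) := {(3, 0, 0), (1, 2, 0), (1, 0, 2), (2, 1, 0), (0, 3, 0), (0, 1, 2), (2, 0, 1), (0, 2, 1), (0, 0, 3)}

/-- The typed assignments are exactly `T9` (one kernel `decide` over the `32³` bit-vector triples). -/
lemma filter_cond : (Finset.univ.filter cond) = T9 := by decide +kernel

/-- The integer shadow of the table entry: the sum over the nine typed assignments of the state kernel
`KB` at the tabled states of the pinned configurations. -/
def entryZ (p q r : Fin 5) : ℤ :=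
  ∑ t ∈ T9, KB (stTab (mix t.1 p)) (stTab (mix t.2.1 q)) (stTab (mix t.2.2 r))

/-- **The partition table of the core is its integer shadow.** -/
theorem partTable5_eq_entryZ (p q r : Fin 5) :
    partTable5 ends S 2 3 4 0 2 3 2 0 1 4 3 F z₀ τ₀ p q r = (entryZ p q r : ℚ) := by
  unfold partTable5 partTable
  rw [typedCount3_eq_sum_setOn, partEnds_eq, K3_eq_stKer]
  simp only [stKer, st_eq_stC]
  unfold entryZ
  rw [← filter_cond, Finset.sum_filter]
  push_cast
  rw [flatten3', ← (cfgEquiv.prodCongr (cfgEquiv.prodCongr cfgEquiv)).symm.sum_comp]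
  refine Finset.sum_congr rfl fun t _ => ?_
  simp only [Equiv.prodCongr_symm, Equiv.prodCongr_apply, Prod.map, cfgEquiv, Equiv.coe_fn_symm_mk]
  have e1 : setOn F (cfgOf t.1) (setOn S (cfg 2 3 4 (rep5 p)) z₀) = cfgOf (mix t.1 p) := setOn_cfgOf t.1 p
  have e2 : setOn F (cfgOf t.2.1) (setOn S (cfg 2 3 4 (rep5 q)) z₀) = cfgOf (mix t.2.1 q) :=
    setOn_cfgOf t.2.1 q
  have e3 : setOn F (cfgOf t.2.2) (setOn S (cfg 2 3 4 (rep5 r)) z₀) = cfgOf (mix t.2.2 r) :=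
    setOn_cfgOf t.2.2 r
  split_ifs
  · rw [e1, e2, e3, stC_cfgOf, stC_cfgOf, stC_cfgOf]
  · rfl

/-- The table (rows `p`, columns `q`, depth `r`). -/
def tbl5 : Fin 5 → Fin 5 → Fin 5 → ℤ :=
  ![![![0, 0, -4, 0, 4], ![0, 0, -4, 0, 2], ![4, -4, 0, 8, 0], ![0, 4, -4, 0, 6], ![4, -2, 0, 6, 0]],
  ![![0, 0, -4, 0, 2], ![0, 0, -4, 0, 0], ![4, -2, 0, 6, 0], ![0, 4, -4, 0, 4], ![4, 0, 0, 4, 0]],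
  ![![0, 0, -2, 0, 4], ![0, 0, -2, 0, 2], ![2, -4, 0, 6, 0], ![0, 2, -2, 0, 4], ![2, -2, 0, 4, 0]],
  ![![0, 0, -4, 0, 4], ![0, 0, -4, 0, 2], ![4, -4, 0, 8, 0], ![0, 4, -4, 0, 6], ![4, -2, 0, 6, 0]],
  ![![0, 0, -2, 0, 2], ![0, 0, -2, 0, 0], ![2, -2, 0, 4, 0], ![0, 2, -2, 0, 2], ![2, 0, 0, 2, 0]]]

set_option maxRecDepth 100000 in
/-- **The `125` entries, by one kernel `decide`.** -/
theorem entryZ_eq : ∀ p q r : Fin 5, entryZ p q r = tbl5 p q r := by decide +kernel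

/-- **The partition table of the core `HOB` is `tbl5`.** -/
theorem partTable5_eq (p q r : Fin 5) :
    partTable5 ends S 2 3 4 0 2 3 2 0 1 4 3 F z₀ τ₀ p q r = (tbl5 p q r : ℚ) := by
  rw [partTable5_eq_entryZ, entryZ_eq]

/-! ## Cubic forms of integer coefficient arrays -/

/-- The cubic form of an integer coefficient array. -/
def cubicZ (A : Fin 5 → Fin 5 → Fin 5 → ℤ) (μ : Fin 5 → ℚ) : ℚ :=
  ∑ p, ∑ q, ∑ r, (A p q r : ℚ) * (μ p * μ q * μ r)

/-- The symmetrisation of a coefficient array (the sum over the six orderings). -/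
def symZ (A : Fin 5 → Fin 5 → Fin 5 → ℤ) (p q r : Fin 5) : ℤ :=
  A p q r + A p r q + A q p r + A q r p + A r p q + A r q p

/-- Swapping the two inner indices of a coefficient array does not change its cubic form. -/
lemma cubicZ_swap23 (A : Fin 5 → Fin 5 → Fin 5 → ℤ) (μ : Fin 5 → ℚ) :
    cubicZ (fun p q r => A p r q) μ = cubicZ A μ := by
  unfold cubicZ
  refine Finset.sum_congr rfl fun p _ => ?_
  rw [Finset.sum_comm]
  refine Finset.sum_congr rfl fun q _ => Finset.sum_congr rfl fun r _ => ?_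
  ring

/-- Swapping the two outer indices does not change the cubic form. -/
lemma cubicZ_swap12 (A : Fin 5 → Fin 5 → Fin 5 → ℤ) (μ : Fin 5 → ℚ) :
    cubicZ (fun p q r => A q p r) μ = cubicZ A μ := by
  unfold cubicZ
  rw [Finset.sum_comm]
  refine Finset.sum_congr rfl fun p _ => Finset.sum_congr rfl fun q _ => Finset.sum_congr rfl fun r _ => ?_
  ring

/-- The cubic form of a sum of arrays. -/
lemma cubicZ_add (A B : Fin 5 → Fin 5 → Fin 5 → ℤ) (μ : Fin 5 → ℚ) :
    cubicZ (fun p q r => A p q r + B p q r) μ = cubicZ A μ + cubicZ B μ := by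
  unfold cubicZ
  simp only [Int.cast_add, add_mul, Finset.sum_add_distrib]

/-- The cubic form of the symmetrisation is six times the cubic form. -/
lemma cubicZ_symZ (A : Fin 5 → Fin 5 → Fin 5 → ℤ) (μ : Fin 5 → ℚ) :
    cubicZ (symZ A) μ = 6 * cubicZ A μ := by
  have e1 : cubicZ (fun p q r => A p r q) μ = cubicZ A μ := cubicZ_swap23 A μ
  have e2 : cubicZ (fun p q r => A q p r) μ = cubicZ A μ := cubicZ_swap12 A μ
  have e3 : cubicZ (fun p q r => A q r p) μ = cubicZ A μ := by
    rw [show (fun p q r => A q r p) = (fun p q r => (fun p q r => A p r q) q p r) from rfl,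
      cubicZ_swap12, cubicZ_swap23]
  have e4 : cubicZ (fun p q r => A r p q) μ = cubicZ A μ := by
    rw [show (fun p q r => A r p q) = (fun p q r => (fun p q r => A q p r) p r q) from rfl,
      cubicZ_swap23, cubicZ_swap12]
  have e5 : cubicZ (fun p q r => A r q p) μ = cubicZ A μ := by
    rw [show (fun p q r => A r q p) = (fun p q r => (fun p q r => A q r p) p r q) from rfl,
      cubicZ_swap23, e3]
  have : cubicZ (symZ A) μ = cubicZ A μ + cubicZ (fun p q r => A p r q) μ + cubicZ (fun p q r => A q p r) μ +
      cubicZ (fun p q r => A q r p) μ + cubicZ (fun p q r => A r p q) μ + cubicZ (fun p q r => A r q p) μ := by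
    unfold symZ
    rw [← cubicZ_add, ← cubicZ_add, ← cubicZ_add, ← cubicZ_add, ← cubicZ_add]
  rw [this, e1, e2, e3, e4, e5]
  ring

/-- **Two coefficient arrays with the same symmetrisation define the same cubic form.** -/
theorem cubicZ_eq_of_symZ {A B : Fin 5 → Fin 5 → Fin 5 → ℤ} (h : ∀ p q r, symZ A p q r = symZ B p q r)
    (μ : Fin 5 → ℚ) : cubicZ A μ = cubicZ B μ := by
  have hA := cubicZ_symZ A μ
  have hB := cubicZ_symZ B μ
  have : cubicZ (symZ A) μ = cubicZ (symZ B) μ := by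
    unfold cubicZ
    simp only [h]
  linarith

/-! ## The certificate and the theorem -/

/-- The bilinear coefficients of the slack `H12 = μ0 μ4 + μ3 μ4 − μ1 μ2` (`d ≥ ab`). -/
def H0 : Fin 5 → Fin 5 → ℤ :=
  ![![0, 0, 0, 0, 1], ![0, 0, -1, 0, 0], ![0, 0, 0, 0, 0], ![0, 0, 0, 0, 1], ![0, 0, 0, 0, 0]]

/-- `H0` is the slack. -/
lemma H0_sum (μ : Fin 5 → ℚ) :
    (∑ q, ∑ r, (H0 q r : ℚ) * (μ q * μ r)) = μ 0 * μ 4 + μ 3 * μ 4 - μ 1 * μ 2 := by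
  simp only [Fin.sum_univ_five, H0]
  simp
  ring

/-- The monomial multipliers of the certificate (certlp.py): ten monomials. -/
def lmZ : Fin 5 → Fin 5 → Fin 5 → ℤ :=
  ![![![0, 0, 0, 0, 0], ![0, 0, 0, 4, 0], ![0, 0, 0, 4, 0], ![0, 0, 0, 0, 8], ![0, 0, 0, 0, 0]],
    ![![0, 0, 0, 0, 0], ![0, 0, 0, 4, 0], ![0, 0, 0, 0, 0], ![0, 0, 0, 4, 4], ![0, 0, 0, 0, 0]],
    ![![0, 0, 0, 0, 0], ![0, 0, 0, 0, 0], ![0, 0, 0, 4, 0], ![0, 0, 0, 4, 4], ![0, 0, 0, 0, 0]],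
    ![![0, 0, 0, 0, 0], ![0, 0, 0, 0, 0], ![0, 0, 0, 0, 0], ![0, 0, 0, 0, 8], ![0, 0, 0, 0, 0]],
    ![![0, 0, 0, 0, 0], ![0, 0, 0, 0, 0], ![0, 0, 0, 0, 0], ![0, 0, 0, 0, 0], ![0, 0, 0, 0, 0]]]

/-- The Harris multipliers: the five generators `μ_i · H12` with weights `8, 6, 6, 4, 4`. -/
def lhZ : Fin 5 → ℤ := ![8, 6, 6, 4, 4]

/-- The generator array: `μ_i · H12` as a coefficient array. -/
def genZ (p q r : Fin 5) : ℤ := lhZ p * H0 q r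

/-- The cubic form of the generator array is the Harris part of the certificate. -/
lemma cubicZ_genZ (μ : Fin 5 → ℚ) :
    cubicZ genZ μ = ∑ p, (lhZ p : ℚ) * (μ p * (μ 0 * μ 4 + μ 3 * μ 4 - μ 1 * μ 2)) := by
  unfold cubicZ genZ
  refine Finset.sum_congr rfl fun p _ => ?_
  rw [← H0_sum μ, Finset.mul_sum, Finset.mul_sum]
  refine Finset.sum_congr rfl fun q _ => ?_
  rw [Finset.mul_sum, Finset.mul_sum]
  refine Finset.sum_congr rfl fun r _ => ?_
  push_cast
  ring

/-- **The certificate identity on the symmetrised coefficients** (one kernel `decide` over `ℤ`). -/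
lemma sym_eq : ∀ p q r : Fin 5, symZ tbl5 p q r = symZ (fun p q r => lmZ p q r + genZ p q r) p q r := by
  decide +kernel

/-- The monomial multipliers are nonnegative. -/
lemma lmZ_nonneg : ∀ i j k : Fin 5, 0 ≤ lmZ i j k := by decide

/-- The Harris multipliers are nonnegative. -/
lemma lhZ_nonneg : ∀ i : Fin 5, 0 ≤ lhZ i := by decide

/-- The multipliers in the cone's format. -/
def lm : Fin 5 → Fin 5 → Fin 5 → ℚ := fun i j k => (lmZ i j k : ℚ)

/-- The Harris multipliers in the cone's format: slack `0` (`H12`) only. -/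
def lh : Fin 5 → Fin 9 → ℚ := fun i s => if s = 0 then (lhZ i : ℚ) else 0

/-- **The five-world cubic of the table is in the Harris cone** — the (3T-CERT) certificate of §37.5
for the core `HOB`: ten monomials and the five generators `μ_i · H12`, the cross-pair deficits
`C_{⊥·01·02} = −8, …` paid by `d ≥ ab`. -/
theorem inCone_HOB :
    InCone (fun ν => ∑ p : Fin 5, ∑ q : Fin 5, ∑ r : Fin 5,
      partTable5 ends S 2 3 4 0 2 3 2 0 1 4 3 F z₀ τ₀ p q r * mono p q r ν) := by
  refine ⟨lm, lh, ?_, ?_, ?_⟩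
  · intro i j k
    unfold lm
    exact_mod_cast lmZ_nonneg i j k
  · intro i s
    unfold lh
    split_ifs
    · exact_mod_cast lhZ_nonneg i
    · exact le_refl 0
  · intro μ
    have hs : ∀ i : Fin 5, (∑ s : Fin 9, lh i s * hgen i s μ) =
        (lhZ i : ℚ) * (μ i * (μ 0 * μ 4 + μ 3 * μ 4 - μ 1 * μ 2)) := by
      intro i
      rw [Finset.sum_eq_single (0 : Fin 9)]
      · simp only [lh, if_true]
        rfl
      · intro s _ hs
        simp only [lh, if_neg hs, zero_mul]
      · intro h; exact absurd (Finset.mem_univ _) h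
    simp only [partTable5_eq, hs]
    change cubicZ tbl5 μ = cubicZ lmZ μ + ∑ p, (lhZ p : ℚ) * (μ p * (μ 0 * μ 4 + μ 3 * μ 4 - μ 1 * μ 2))
    rw [← cubicZ_genZ, ← cubicZ_add]
    exact cubicZ_eq_of_symZ sym_eq μ

/-- **ROW 2′TRI ON THE CORE `HOB` PLUS THE STAR, FOR EVERY TYPE MAP ON THE STAR** — the chain of
§38–§39 end to end: the kernel-evaluated table, its certificate, `typedHarris_part` (nothing to check
on the star) and `typedCount_part_nonneg_of_inCone5'`. -/
theorem typedCount_nonneg_HOB (τ : Fin 5 → ℕ) (h0 : τ 0 = 1) (h1 : τ 1 = 1) :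
    0 ≤ typedCount (F ∪ S) z₀ τ (CovForm.K3 (R := ℚ) ends 2 0 1 4 3) := by
  have hτ : ∀ e ∈ F, τ e = τ₀ e := by
    intro e he
    simp only [F, Finset.mem_insert, Finset.mem_singleton] at he
    rcases he with rfl | rfl
    · exact h0
    · exact h1
  have hW : IsPart ends {5} 0 2 3 :=
    isPart_star (ends := ends) (u := 5) (t₁ := 0) (t₂ := 2) (t₃ := 3) (e₁ := 2) (e₂ := 3) (e₃ := 4)
      rfl rfl rfl (by decide) (by decide) (by decide) hS
  refine typedCount_part_nonneg_of_inCone5' (ends := ends) (W := {5}) (t₁ := 0) (t₂ := 2) (t₃ := 3) hW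
    (S := S) hS (e₁ := 2) (e₂ := 3) (e₃ := 4) (by decide) (by decide) (by decide) (by decide) (by decide)
    (by decide) (o := 2) (a₁ := 0) (a₂ := 1) (a₃ := 4) (b := 3) (by simp) (by simp) (by simp) (by simp)
    (by simp) (F := F) (Finset.disjoint_left.2 (by decide)) z₀ τ ?_
  have : (fun ν => ∑ p : Fin 5, ∑ q : Fin 5, ∑ r : Fin 5,
      partTable5 ends S 2 3 4 0 2 3 2 0 1 4 3 F z₀ τ p q r * mono p q r ν) =
      (fun ν => ∑ p : Fin 5, ∑ q : Fin 5, ∑ r : Fin 5,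
      partTable5 ends S 2 3 4 0 2 3 2 0 1 4 3 F z₀ τ₀ p q r * mono p q r ν) := by
    funext ν
    simp only [partTable5_congr_τ ends S 2 3 4 0 2 3 2 0 1 4 3 F z₀ hτ]
  rw [this]
  exact inCone_HOB

end InstHOB

end Summit.Ventures.PercRepro2
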